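import Summits.AtomisticToContinuum.Crystallization.Theses.ThreeConeCertificate
import Summits.AtomisticToContinuum.Crystallization.Theorems.ChargedEnergyGap.Negative.BlocksBound

/-!
# Sketch — crux ExactCertificate (stmt-AtomisticToContinuum-11959), crux-ideate round 1, ideator k = 1

First lemmas of the two idea cards (`tail-first-bochner-completion`, `closure-makes-nogap-exact`):

* `IsRadialPD`, `IsStable`, `IsCertificate` — the crux's cones, named;
* `exact_of_single` (PROVED): the single-unknown form — a radial PD `f` with `f ≤ V_LJ` on `[ρ,∞)`
  whose core remainder `(V_LJ − f)·1_{(0,ρ)}` is stable with the forced constant `−e(P) − f(0)/2`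
  is an exact three-cone witness (take `U := (V_LJ − f)·1_{[ρ,∞)}`);
* `innerFunctional`, `tailTwice`, `TailNoGap`, `tail_lower_bound` — the TAIL objects: for every
  radial PD `f` with `f ≤ V_LJ` beyond `ρ`, `f(0) + Σ_{inner shells} m_n f(r_n) ≥ 2|e_T(P,ρ)|`
  (Bochner on blocks of `P`), with equality iff `f` is a tail interpolant; `TailNoGap` = the infimum
  is `2|e_T|`;
* `NoGap`, `value_ge` (weak duality), `exact_of_noGap` — the CLOSURE LEMMA: at fixed `(P, ρ)`
  certificates with values `→ e(P)` have an exact limit (limsup/liminf in the three cones; the slack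
  cone absorbs all non-compactness), so `ExactCertificate(P,ρ) ↔ NoGap(P,ρ)`.
-/

namespace Summit.AtomisticToContinuum.Crystallization.Cruxes.ExactCertificate.IdeatorOne

open Literature.MathematicalPhysics.StatisticalMechanics
open Summit.AtomisticToContinuum.Crystallization.Theses.ThreeConeCertificate
open scoped BigOperators

noncomputable section

abbrev E3 := EuclideanSpace ℝ (Fin 3)

/-- Radial positive type in the finite-form sense of the crux (Ruelle (2.18)); coincident points
allowed, diagonal `f 0`. -/
def IsRadialPD (f : ℝ → ℝ) : Prop :=
  ∀ (n : ℕ) (y : Fin n → E3) (w : Fin n → ℝ), 0 ≤ ∑ i, ∑ j, w i * w j * f (dist (y i) (y j))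

/-- `c`-stability of a pair potential on injective configurations. -/
def IsStable (g : ℝ → ℝ) (c : ℝ) : Prop :=
  ∀ (N : ℕ) (x : Fin N → E3), Function.Injective x → -(c * (N : ℝ)) ≤ interactionEnergy g x

/-- A range-`ρ` three-cone certificate for Lennard-Jones with constant `c` (its value is
`−(c + f 0 / 2)`). -/
def IsCertificate (ρ c : ℝ) (g U f : ℝ → ℝ) : Prop :=
  (∀ r : ℝ, 0 < r → lennardJones r = g r + U r + f r) ∧ (∀ r : ℝ, 0 < r → 0 ≤ U r) ∧
  (∀ r : ℝ, ρ ≤ r → g r = 0) ∧ IsRadialPD f ∧ IsStable g c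

theorem exactCertificate_iff :
    ExactCertificate ↔ ∃ (P : PeriodicConfiguration 3) (ρ c : ℝ) (g U f : ℝ → ℝ),
      IsCertificate ρ c g U f ∧ c + f 0 / 2 = -(P.energyPerParticle lennardJones) := by
  unfold ExactCertificate IsCertificate IsRadialPD IsStable
  constructor
  · rintro ⟨P, ρ, c, g, U, f, h1, h2, h3, h4, h5, h6⟩
    exact ⟨P, ρ, c, g, U, f, ⟨h1, h2, h3, h4, h5⟩, h6⟩
  · rintro ⟨P, ρ, c, g, U, f, ⟨h1, h2, h3, h4, h5⟩, h6⟩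
    exact ⟨P, ρ, c, g, U, f, h1, h2, h3, h4, h5, h6⟩

/-! ## Single-unknown form (refuter's reformulation, here PROVED in the useful direction) -/

/-- The core remainder of `f` at range `ρ`: `(V_LJ − f)` inside `ρ`, `0` from `ρ` on. -/
def coreRemainder (ρ : ℝ) (f : ℝ → ℝ) : ℝ → ℝ := fun r => if r < ρ then lennardJones r - f r else 0

/-- The forced stability constant of any exact witness built on `(P, f)`. -/
def forcedConstant (P : PeriodicConfiguration 3) (f : ℝ → ℝ) : ℝ :=
  -(P.energyPerParticle lennardJones) - f 0 / 2

/-- **Single-unknown sufficiency.** A radial PD `f` lying below `V_LJ` on `[ρ,∞)` whose core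
remainder is stable with the forced constant gives an exact three-cone certificate
(`g := coreRemainder ρ f`, `U := (V_LJ − f)·1_{[ρ,∞)}`, `c := forcedConstant P f`). -/
theorem exact_of_single (P : PeriodicConfiguration 3) (ρ : ℝ) (f : ℝ → ℝ)
    (hpd : IsRadialPD f) (htail : ∀ r : ℝ, ρ ≤ r → f r ≤ lennardJones r)
    (hcore : IsStable (coreRemainder ρ f) (forcedConstant P f)) : ExactCertificate := by
  refine ⟨P, ρ, forcedConstant P f, coreRemainder ρ f,
    fun r => if r < ρ then 0 else lennardJones r - f r, f, ?_, ?_, ?_, hpd, hcore, ?_⟩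
  · intro r _
    by_cases h : r < ρ <;> simp only [coreRemainder, h, if_true, if_false] <;> ring
  · intro r _
    by_cases h : r < ρ
    · simp only [h, if_true, le_refl]
    · simp only [h, if_false, sub_nonneg]
      exact htail r (not_lt.mp h)
  · intro r hr
    simp only [coreRemainder, not_lt.mpr hr, if_false]
  · simp only [forcedConstant]; ring

/-! ## Tail objects (card `tail-first-bochner-completion`) -/

/-- `L(f) = f(0) + (#F)⁻¹ Σ_{x ∈ F} Σ_{y ∈ P, 0 < |x−y| < ρ} f |x − y|` — the inner `P`-sum of `f`
(a finite sum: finitely many points of `P` within `ρ` of each motif point). -/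
def innerFunctional (P : PeriodicConfiguration 3) (ρ : ℝ) (f : ℝ → ℝ) : ℝ :=
  f 0 + ((P.motif.card : ℝ))⁻¹ *
    ∑ x ∈ P.motif, ∑' y : {y : E3 // y ∈ P.points ∧ y ≠ x ∧ dist x y < ρ}, f (dist x y.1)

/-- `2|e_T(P,ρ)| = −(#F)⁻¹ Σ_{x ∈ F} Σ_{y ∈ P, |x−y| ≥ ρ} V_LJ |x − y|` — twice the (negative) tail
energy per particle of `P` beyond `ρ`, sign flipped. -/
def tailTwice (P : PeriodicConfiguration 3) (ρ : ℝ) : ℝ :=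
  -(((P.motif.card : ℝ))⁻¹ *
    ∑ x ∈ P.motif, ∑' y : {y : E3 // y ∈ P.points ∧ y ≠ x ∧ ρ ≤ dist x y}, lennardJones (dist x y.1))

/-- **Tail lower bound** (Bochner on blocks of `P`; the identity
`L(f) − 2|e_T| = ⟨f, γ_P⟩ + Σ_outer m_n (V − f)(r_n)` with both terms `≥ 0`). Stated for bounded
`f` with absolutely summable `P`-sum (automatic for a tail interpolant). -/
theorem tail_lower_bound (P : PeriodicConfiguration 3) (ρ : ℝ) (f : ℝ → ℝ)
    (hpd : IsRadialPD f) (htail : ∀ r : ℝ, ρ ≤ r → f r ≤ lennardJones r)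
    (hsum : ∀ x ∈ P.motif, Summable fun y : {y : E3 // y ∈ P.points ∧ y ≠ x} => f (dist x y.1)) :
    tailTwice P ρ ≤ innerFunctional P ρ f := by
  sorry

/-- `TailNoGap P ρ`: radial PD functions below `V_LJ` on the tail bring the inner functional down to
`2|e_T|` — by LP duality, "the far shells of `P` are the `V_LJ`-optimal positive-definite
completion of its near shells" (tail self-optimality). Necessary for an exact witness at `(P,ρ)`
(then even attained: `innerFunctional P ρ f = tailTwice P ρ`). -/
def TailNoGap (P : PeriodicConfiguration 3) (ρ : ℝ) : Prop :=
  ∀ ε : ℝ, 0 < ε → ∃ f : ℝ → ℝ, IsRadialPD f ∧ (∀ r : ℝ, ρ ≤ r → f r ≤ lennardJones r) ∧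
    (∀ x ∈ P.motif, Summable fun y : {y : E3 // y ∈ P.points ∧ y ≠ x} => f (dist x y.1)) ∧
    innerFunctional P ρ f ≤ tailTwice P ρ + ε

/-- The exact tail condition every witness satisfies (forced by complementary slackness against
`P`-blocks): `L(f) = 2|e_T(P,ρ)|`. -/
def TailInterpolant (P : PeriodicConfiguration 3) (ρ : ℝ) (f : ℝ → ℝ) : Prop :=
  IsRadialPD f ∧ (∀ r : ℝ, ρ ≤ r → f r ≤ lennardJones r) ∧
    (∀ x ∈ P.motif, Summable fun y : {y : E3 // y ∈ P.points ∧ y ≠ x} => f (dist x y.1)) ∧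
    innerFunctional P ρ f = tailTwice P ρ

/-- Necessity of the tail condition (the `P`-block argument): any exact witness, after the WLOG
`U = 0` on `(0,ρ)`, is a tail interpolant for its own `(P, ρ)`. -/
theorem tailInterpolant_of_exact (P : PeriodicConfiguration 3) (ρ c : ℝ) (g U f : ℝ → ℝ)
    (h : IsCertificate ρ c g U f) (hv : c + f 0 / 2 = -(P.energyPerParticle lennardJones))
    (hsum : ∀ x ∈ P.motif, Summable fun y : {y : E3 // y ∈ P.points ∧ y ≠ x} => f (dist x y.1)) :
    TailInterpolant P ρ f := by
  sorry

/-! ## Closure (card `closure-makes-nogap-exact`) -/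

/-- `NoGap P ρ`: range-`ρ` certificates come arbitrarily close to the value `e(P)`. -/
def NoGap (P : PeriodicConfiguration 3) (ρ : ℝ) : Prop :=
  ∀ ε : ℝ, 0 < ε → ∃ (c : ℝ) (g U f : ℝ → ℝ), IsCertificate ρ c g U f ∧
    c + f 0 / 2 ≤ -(P.energyPerParticle lennardJones) + ε

/-- Weak duality: no certificate beats `e(P)` (CertificateBound on `P`-blocks + the trial-state
limit `E(P ∩ B_R)/N_R → e(P)`). -/
theorem value_ge (P : PeriodicConfiguration 3) (ρ c : ℝ) (g U f : ℝ → ℝ)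
    (h : IsCertificate ρ c g U f) : -(P.energyPerParticle lennardJones) ≤ c + f 0 / 2 := by
  sorry

/-- **Closure lemma (First lemma of card `closure-makes-nogap-exact`).** At fixed `(P, ρ)`, no
duality gap forces an exact witness.  Proof by ULTRALIMIT (no analysis): along certificates
`(c_j, g_j, U_j, f_j)` with values `→ e(P)` every pointwise sequence is bounded for `r > 0` (values at `r < 0`, and of `g_j, U_j` at `0`, never
enter any clause and are zeroed first; `|f_j r| ≤ f_j 0 ≤ M`,
`−2c_j ≤ g_j r ≤ V r + M`, `0 ≤ U_j r ≤ V r + 2c_j + M`, `0 ≤ c_j ≤ C`); take a non-principal ultrafilter `𝒰`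
and put `f := lim_𝒰 f_j`, `g := lim_𝒰 g_j`, `U := lim_𝒰 U_j`, `c := lim_𝒰 c_j` pointwise.  `lim_𝒰` is linear
and monotone, so each clause (split on `(0,∞)`, `U ≥ 0`, `g = 0` on `[ρ,∞)`, every finite quadratic form
`≥ 0`, every finite stability inequality) passes to the limit, and `c + f 0 / 2 = lim_𝒰 (c_j + f_j 0 / 2)
= −e(P)` since the sequence converges (`value_ge` gives `≥ −e(P)` termwise). -/
theorem exact_of_noGap (P : PeriodicConfiguration 3) (ρ : ℝ) (h : NoGap P ρ) :
    ExactCertificate := by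
  sorry

/-- Conversely an exact witness trivially gives `NoGap`. -/
theorem noGap_of_exact (P : PeriodicConfiguration 3) (ρ c : ℝ) (g U f : ℝ → ℝ)
    (h : IsCertificate ρ c g U f) (hv : c + f 0 / 2 = -(P.energyPerParticle lennardJones)) :
    NoGap P ρ := by
  intro ε hε
  exact ⟨c, g, U, f, h, by linarith⟩


/-! ## P-free form, aligned with the standing Disproof.lean (cycle 1, 2026-08-16T00:56Z)

`Disproof.exactCertificate_iff_sharp_and_kepler : ExactCertificate ↔ SharpSplit ∧ KeplerBound` makes the
value equation `P`-free (`SharpSplit`: some split has `c + f 0/2 ≤ −e*`).  The closure lemma at fixed range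
then reads `NoGapAt ρ → SharpAt ρ`, and the tail/core split of card tail-first applies to `SharpAt ρ`. -/

section PFree
-- `Disproof.lean` is not yet built on the farm snapshot (rc 75 "unbuilt" at 01:10Z), so it is not imported;
-- `IsSplit` there is literally `IsCertificate` here, and `eStar = ⨅_Q e_LJ(Q)` comes from BlocksBound.
open Summit.AtomisticToContinuum.Crystallization.Theorems.ChargedEnergyGapNegative (eStar)

/-- Sharpness of the three-cone bound AT range `ρ` (P-free). -/
def SharpAt (ρ : ℝ) : Prop := ∃ (c : ℝ) (g U f : ℝ → ℝ), IsCertificate ρ c g U f ∧ c + f 0 / 2 ≤ -eStar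

/-- No duality gap AT range `ρ` (P-free): splits of range `ρ` come within every `ε` of `−e*`. -/
def NoGapAt (ρ : ℝ) : Prop :=
  ∀ ε : ℝ, 0 < ε → ∃ (c : ℝ) (g U f : ℝ → ℝ), IsCertificate ρ c g U f ∧ c + f 0 / 2 ≤ -eStar + ε

/-- **Closure lemma, P-free form**: the set of values of range-`ρ` splits is closed at its floor `−e*`
(`IsSplit.value_ge`, proved in Disproof.lean): the pointwise ultralimit of near-optimal splits is a sharp
split (same bookkeeping as `exact_of_noGap`). -/
theorem sharpAt_of_noGapAt (ρ : ℝ) (h : NoGapAt ρ) : SharpAt ρ := by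
  sorry

theorem noGapAt_of_sharpAt (ρ : ℝ) (h : SharpAt ρ) : NoGapAt ρ := by
  obtain ⟨c, g, U, f, hs, hv⟩ := h
  exact fun ε hε => ⟨c, g, U, f, hs, by linarith⟩

/-- With `Disproof.exactCertificate_iff_sharp_and_kepler` (`ExactCertificate ↔ SharpSplit ∧ KeplerBound`,
proved there, `SharpSplit = ∃ ρ, SharpAt ρ` verbatim) the closure lemma gives
`ExactCertificate ↔ (∃ ρ, NoGapAt ρ) ∧ KeplerBound`; stated here against that factorisation as a hypothesis. -/
theorem exactCertificate_iff_noGapAt_and_kepler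
    (hfact : ExactCertificate ↔ (∃ ρ, SharpAt ρ) ∧ KeplerBound) :
    ExactCertificate ↔ (∃ ρ, NoGapAt ρ) ∧ KeplerBound := by
  rw [hfact]
  constructor
  · rintro ⟨⟨ρ, h⟩, hK⟩
    exact ⟨⟨ρ, noGapAt_of_sharpAt ρ h⟩, hK⟩
  · rintro ⟨⟨ρ, h⟩, hK⟩
    exact ⟨⟨ρ, sharpAt_of_noGapAt ρ h⟩, hK⟩

/-- Monotonicity of the gap profile: `NoGapAt` is an up-set in `ρ` (from `IsSplit.mono`). -/
theorem noGapAt_mono {ρ ρ' : ℝ} (hρ : ρ ≤ ρ') (h : NoGapAt ρ) : NoGapAt ρ' := by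
  intro ε hε
  obtain ⟨c, g, U, f, ⟨h1, h2, h3, h4, h5⟩, hv⟩ := h ε hε
  exact ⟨c, g, U, f, ⟨h1, h2, fun r hr => h3 r (le_trans hρ hr), h4, h5⟩, hv⟩

end PFree

end

end Summit.AtomisticToContinuum.Crystallization.Cruxes.ExactCertificate.IdeatorOne
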